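import Summits.PneNP.PneNP.Theses.ExpanderLinearGenerators
import Literature.Computability.MetaComplexity.ProofSystemsTautProofs
import Literature.Computability.MetaComplexity.GeneratorHardnessCriterion
import Literature.Computability.Complexity.PCPProofs
import Literature.Computability.Complexity.NegCNFTranscoder
import Literature.Computability.Complexity.StringCopy
import Literature.Computability.Complexity.PairProjections

/-!
# Crux `ProofcplxThesis` (stmt-PneNP-0097): load-bearing clauses and refuted strengthenings

Negative lemmas (`--supports stmt-PneNP-0097`) of the crux disprover
`refuter-cdisprove-stmt-PneNP-0097-0` (cycle 1, 2026-08-17) for the rank-0 crux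
`X := Summit.PneNP.PneNP.Theses.ExpanderLinearGenerators.NoPolyBoundedProofSystem`
(`= ProofCplx.ProofcplxThesis`, `Iff.rfl`) `:= ¬ HasPolyBoundedProofSystem TAUT` — "no Cook–Reckhow
proof system for `TAUT` is polynomially bounded", kernel-equivalent in the tree to `NP ≠ coNP`
(`Theorems/ExpanderLinearGeneratorsNoPolyBoundedProofSystem.lean`). Nothing here asserts `X` or `¬X`;
the file records, sorry-free, what every DISPROOF of `X` must overcome and which over-claims around `X`
are already false (work file: `Cruxes/ProofcplxThesis/Disproof.lean`).

* §1 LOAD-BEARING CLAUSES. `X = ¬ ∃ V, (poly-time V ∧ sound-and-complete V) ∧ poly-bounded V`.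
  Each clause is load-bearing: with any one dropped the existential has a trivial witness and the
  weakened `X` is FALSE — `x_false_without_polyTime` (classical indicator of `TAUT`, proofs of length
  `0`), `x_false_without_polyBounded` (`TAUT` has a proof system, `exists_isProofSystemFor_TAUT_holds`),
  `x_false_without_soundness` (accept everything), `x_false_without_completeness` (accept nothing).
* §2 REFUTED STRENGTHENINGS. `not_X_for_SAT` (the `SAT` analogue is false: `SAT ∈ NP`);
  `not_forall_coNP_noPolyBounded` (the class-wide `coNP` form is false: `P` languages);
  `not_exists_easy_hard_core`: NO `P`-decidable set of tautologies is hard for all proof systems —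
  any proof system `V₀` for `TAUT` extends to one accepting all `V₀`-proofs in which a given easy
  `H ⊆ TAUT` has the empty proof (`easy_subset_has_trivial_proofs`). Reading for the ladder routes on
  `X`: a `τ`-family whose parameter set is in `P` (for Krajíček's LINEAR generator, `b ∉ Im A` is
  Gaussian elimination) can be hard for particular systems (the rungs) but never for all, so it cannot
  witness `X`; hardness for all systems needs a non-easy co-range (Krajíček 2019, Lemma 19.4.1, tree:
  `range_hits_NP_iff_proofSystems_finite`).
  Sharp form (appended, same cycle): `not_exists_np_hard_core` — no `NP` set of tautologies is hard
  for all proof systems (`np_subset_has_short_proofs`: the `NP`-witness is the proof); with Krajíček's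
  criterion, a set of tautologies is hard for all systems iff all its `NP` subsets are finite.

Sources: S. A. Cook, R. A. Reckhow, J. Symb. Logic 44 (1979) §1 (Def. 1.3, Prop. 1.4);
J. Krajíček, *Proof complexity* (CUP 2019) §1.1, Lemma 19.4.1, Problem 1.5.3; Z. Sadowski, *On an
optimal propositional proof system and the structure of easy subsets of TAUT*, TCS 288 (2002);
J. Köbler, J. Messner, J. Torán, *Optimal proof systems imply complete sets for promise classes*,
Inf. Comput. 184 (2003).
-/

set_option linter.dupNamespace false -- `Summit.PneNP.PneNP.…` (single-conjunct summit, D-0017)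

namespace Summit.PneNP.PneNP.Theorems.ProofcplxThesis.Negative

open Literature.Computability.Complexity Literature.Computability.MetaComplexity
open Summit.PneNP.PneNP.Theses

/-- `X` unfolded to its four clauses (definitional): no `V` is at once a polynomial-time verifier,
sound and complete for `TAUT`, and polynomially bounded. [cite: CookReckhow1979, §1 Def. 1.3] -/
theorem noPolyBoundedProofSystem_iff_clauses :
    ExpanderLinearGenerators.NoPolyBoundedProofSystem ↔ ¬ ∃ V : List Bool → List Bool → Bool,
      (IsPolyTimeVerifier V ∧ ∀ x, x ∈ TAUT ↔ ∃ π, V x π = true) ∧ IsPolyBounded V :=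
  Iff.rfl

/-! ## §1 Load-bearing clauses: drop one, and the weakened crux is false -/

/-- **`X` without the POLYNOMIAL-TIME clause is false.** The weakened crux
`¬ ∃ V, (sound ∧ complete for TAUT) ∧ poly-bounded` fails: the (noncomputable) indicator of `TAUT`,
ignoring the proof, is sound, complete and polynomially bounded with proofs of length `0`. Any proof
of `X` must use the time bound of the verifier. [folklore] -/
theorem x_false_without_polyTime :
    ¬ ¬ ∃ V : List Bool → List Bool → Bool, (∀ x, x ∈ TAUT ↔ ∃ π, V x π = true) ∧ IsPolyBounded V := by
  classical
  intro h
  apply h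
  refine ⟨fun x _ => decide (x ∈ TAUT), fun x => ?_, ⟨0, fun x π hπ => ⟨[], by simp, hπ⟩⟩⟩
  constructor
  · intro hx
    exact ⟨[], by simpa using hx⟩
  · rintro ⟨_, hx⟩
    simpa using hx

/-- **`X` without the POLYNOMIAL-BOUNDEDNESS clause is false** ("`TAUT` has no proof system at
all" fails): `TAUT` has a Cook–Reckhow proof system (the tree's machine-verified `textbookFrege`
verifier behind a codeword test, `exists_isProofSystemFor_TAUT_holds`; in print: truth tables). Any
proof of `X` must use the length bound. [cite: CookReckhow1979, §1 (Def. 1.3, remark)] -/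
theorem x_false_without_polyBounded :
    ¬ ¬ ∃ V : List Bool → List Bool → Bool, IsProofSystemFor V TAUT := by
  intro h
  have h' : ∃ V, IsProofSystemFor V TAUT := exists_isProofSystemFor_TAUT_holds
  exact h h'

/-- **`X` without SOUNDNESS is false** (only completeness `x ∈ TAUT → ∃ π, V x π` kept): the
verifier accepting everything is polynomial-time (`PolyTimeComputable.const`), complete and
polynomially bounded. [folklore] -/
theorem x_false_without_soundness :
    ¬ ¬ ∃ V : List Bool → List Bool → Bool,
      IsPolyTimeVerifier V ∧ (∀ x ∈ TAUT, ∃ π, V x π = true) ∧ IsPolyBounded V := by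
  intro h
  apply h
  refine ⟨fun _ _ => true, ?_, fun x _ => ⟨[], rfl⟩, ⟨0, fun x π _ => ⟨[], by simp, rfl⟩⟩⟩
  exact PolyTimeComputable.const _ _ true

/-- **`X` without COMPLETENESS is false** (only soundness `V x π → x ∈ TAUT` kept): the verifier
accepting nothing is polynomial-time, sound and (vacuously) polynomially bounded. [folklore] -/
theorem x_false_without_completeness :
    ¬ ¬ ∃ V : List Bool → List Bool → Bool,
      IsPolyTimeVerifier V ∧ (∀ x π, V x π = true → x ∈ TAUT) ∧ IsPolyBounded V := by
  intro h
  apply h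
  refine ⟨fun _ _ => false, ?_, fun x π hx => absurd hx (by simp), ⟨0, fun x π hx => absurd hx (by simp)⟩⟩
  exact PolyTimeComputable.const _ _ false

/-! ## §2 Refuted strengthenings -/

/-- Every `NP` language has a polynomially bounded proof system (Cook–Reckhow Prop. 1.4, tree:
`hasPolyBoundedProofSystem_iff_mem_NP_holds`). [cite: CookReckhow1979, §1 Prop. 1.4] -/
theorem hasPolyBoundedProofSystem_of_mem_NP {L : Language Bool} (hL : L ∈ Nondeterministic.NP) :
    HasPolyBoundedProofSystem L :=
  (hasPolyBoundedProofSystem_iff_mem_NP_holds : HasPolyBoundedProofSystem L ↔ L ∈ Nondeterministic.NP).2 hL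

/-- Every `P` language has a polynomially bounded proof system. [cite: CookReckhow1979, §1 Prop. 1.4] -/
theorem hasPolyBoundedProofSystem_of_mem_P {L : Language Bool} (hL : L ∈ Classes.P) :
    HasPolyBoundedProofSystem L :=
  hasPolyBoundedProofSystem_of_mem_NP (P_subset_NP_holds hL)

/-- STRENGTHENING REFUTED (the `SAT` analogue of `X`): `SAT` HAS a polynomially bounded proof system
(the satisfying assignment), so `X` is specific to the `coNP` side. [cite: CookReckhow1979, §1 Prop. 1.4] -/
theorem not_X_for_SAT : ¬ ¬ HasPolyBoundedProofSystem SAT := fun h =>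
  h (hasPolyBoundedProofSystem_of_mem_NP (SAT_mem_NP_holds : SAT ∈ Nondeterministic.NP))

/-- STRENGTHENING REFUTED (uniform over `coNP`): it is false that NO `coNP` language has a
polynomially bounded proof system — every `P` language is in `coNP` and has one (witness: the
length-test language `LenLe 0 ∈ P`). So `X` cannot be attacked "class-wide"; it is about the
`coNP`-complete `TAUT` specifically. [folklore] -/
theorem not_forall_coNP_noPolyBounded :
    ¬ ∀ L ∈ coNP, ¬ HasPolyBoundedProofSystem L := by
  intro h
  have hP : (LenLe 0 : Language Bool) ∈ Classes.P := LenLe_mem_P 0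
  have hco : (LenLe 0 : Language Bool) ∈ coNP := by
    show (LenLe 0 : Language Bool)ᶜ ∈ Nondeterministic.NP
    exact P_subset_NP_holds (compl_mem_P_iff.2 hP)
  exact h _ hco (hasPolyBoundedProofSystem_of_mem_P hP)

/-- The language of pairs accepted by a polynomial-time verifier is in `P` (its machine after the
re-pairing machine `polyTimeComputable_boolUnpair`; as in the proof of Cook–Reckhow Prop. 1.4).
[cite: CookReckhow1979, §1 Prop. 1.4 (proof)] -/
theorem pairLang_mem_P {V : List Bool → List Bool → Bool} (hV : IsPolyTimeVerifier V) :
    ({w | Function.uncurry V (boolUnpair w) = true} : Language Bool) ∈ Classes.P := by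
  set L' : Language Bool := {w | Function.uncurry V (boolUnpair w) = true} with hL'
  refine mem_P_iff_holds.2 (polyTimeDecidable_iff.2 ?_)
  have hcomp : PolyTimeComputable (id : List Bool → List Bool) _root_.Computability.encodeBool
      (Function.uncurry V ∘ boolUnpair) :=
    PolyTimeComputable.comp_holds hV polyTimeComputable_boolUnpair
  have hind : L'.boolIndicator = Function.uncurry V ∘ boolUnpair := by
    funext w
    by_cases hw : Function.uncurry V (boolUnpair w) = true
    · rw [(Set.mem_iff_boolIndicator L' w).1 hw]
      exact hw.symm
    · rw [(Set.notMem_iff_boolIndicator L' w).1 hw]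
      simp only [Function.comp_apply]
      cases h : Function.uncurry V (boolUnpair w)
      · rfl
      · exact absurd h hw
  rw [hind]
  exact hcomp

/-- **Easy sets of tautologies have trivial proofs in some extension of any proof system.** For
`H ∈ P`, `H ⊆ TAUT`, and any proof system `V₀` for `TAUT`, the verifier
`V x π := [x ∈ H ∨ V₀ x π]` is a proof system for `TAUT` that accepts every `V₀`-proof and gives each
member of `H` the EMPTY proof. (Folklore; the trivial direction of the easy-subsets/optimality theory,
Sadowski, TCS 288 (2002); Köbler–Messner–Torán, Inf. Comput. 184 (2003).) [folklore] -/
theorem easy_subset_has_trivial_proofs {H : Language Bool} (hH : H ∈ Classes.P) (hHT : H ≤ TAUT)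
    {V₀ : List Bool → List Bool → Bool} (hV₀ : IsProofSystemFor V₀ TAUT) :
    ∃ V : List Bool → List Bool → Bool, IsProofSystemFor V TAUT ∧
      (∀ x π, V₀ x π = true → V x π = true) ∧ ∀ x ∈ H, V x [] = true := by
  set W : Language Bool :=
    (((fun z => (boolUnpair z).1) ⁻¹' (H : Set (List Bool)) : Set (List Bool)) : Language Bool) ⊔
      {w | Function.uncurry V₀ (boolUnpair w) = true} with hWdef
  have hW : W ∈ Classes.P :=
    union_mem_P (preimage_mem_P hH boolUnpairFst_mem_FP) (pairLang_mem_P hV₀.1)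
  have hmemW : ∀ x π : List Bool, boolPair x π ∈ W ↔ x ∈ H ∨ V₀ x π = true := fun x π => by
    change (boolUnpair (boolPair x π)).1 ∈ H ∨ Function.uncurry V₀ (boolUnpair (boolPair x π)) = true ↔ _
    rw [boolUnpair_boolPair]
    rfl
  let V : List Bool → List Bool → Bool := fun x π => W.boolIndicator (boolPair x π)
  have hVtrue : ∀ x π, V x π = true ↔ boolPair x π ∈ W := fun x π =>
    (Set.mem_iff_boolIndicator W (boolPair x π)).symm
  refine ⟨V, ⟨isPolyTimeVerifier_boolIndicator_of_mem_P hW, fun x => ?_⟩, fun x π hπ => ?_, fun x hx => ?_⟩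
  · constructor
    · intro hx
      obtain ⟨π, hπ⟩ := (hV₀.mem_iff x).1 hx
      exact ⟨π, (hVtrue x π).2 ((hmemW x π).2 (Or.inr hπ))⟩
    · rintro ⟨π, hπ⟩
      rcases (hmemW x π).1 ((hVtrue x π).1 hπ) with hxH | hV₀π
      · exact hHT hxH
      · exact hV₀.mem_of_eq_true hV₀π
  · exact (hVtrue x π).2 ((hmemW x π).2 (Or.inr hπ))
  · exact (hVtrue x []).2 ((hmemW x []).2 (Or.inl hx))

/-- **STRENGTHENING REFUTED: no easy set of tautologies is hard for all proof systems.** It is FALSE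
that some `P`-decidable `H ⊆ TAUT` has, against EVERY proof system for `TAUT` and every polynomial
bound, a member without short proofs: extend the tree's proof system for `TAUT` by `H` as an axiom
scheme (`easy_subset_has_trivial_proofs`); then every member of `H` has the proof `[]` of length
`0 ≤ p(|x|)`. Consequence for the route: a `τ`-family whose parameter set is in `P` (e.g. `b ∉ Im A`
for a LINEAR map `A`) is never hard for all proof systems; hardness for all systems (and hence `X`)
needs a non-easy co-range (Krajíček's generator conjecture). [folklore] -/
theorem not_exists_easy_hard_core :
    ¬ ∃ H : Language Bool, H ∈ Classes.P ∧ H ≤ TAUT ∧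
      ∀ V : List Bool → List Bool → Bool, IsProofSystemFor V TAUT → ∀ p : Polynomial ℕ,
        ∃ x ∈ H, ∀ π : List Bool, π.length ≤ p.eval x.length → V x π = false := by
  rintro ⟨H, hH, hHT, hhard⟩
  have h₀ : ∃ V₀, IsProofSystemFor V₀ TAUT := exists_isProofSystemFor_TAUT_holds
  obtain ⟨V₀, hV₀⟩ := h₀
  obtain ⟨V, hV, -, hHV⟩ := easy_subset_has_trivial_proofs hH hHT hV₀
  obtain ⟨x, hx, hno⟩ := hhard V hV 0
  have := hno [] (by simp)
  rw [hHV x hx] at this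
  exact Bool.noConfusion this

/-- **`NP` sets of tautologies have SHORT proofs in some extension of any proof system.** For
`H ∈ NP`, `H ⊆ TAUT`, and any proof system `V₀` for `TAUT`, the verifier
`V x π := [(|π| ≤ p |x| ∧ ⟨x, π⟩ ∈ L') ∨ V₀ x π]` (where `L' ∈ P`, `p` present `H`) is a proof system
for `TAUT` that accepts every `V₀`-proof and gives each member of `H` its `NP`-witness as a proof of
length `≤ p(|x|)`. This is the converse half of Krajíček's Lemma 19.4.1 read for arbitrary subsets of
`TAUT` (tree: `range_hits_NP_of_finite_short_proofs` for co-ranges). [cite: KrajicekProofComplexity2019, Lemma 19.4.1] -/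
theorem np_subset_has_short_proofs {H : Language Bool} (hH : H ∈ Nondeterministic.NP) (hHT : H ≤ TAUT)
    {V₀ : List Bool → List Bool → Bool} (hV₀ : IsProofSystemFor V₀ TAUT) :
    ∃ V : List Bool → List Bool → Bool, IsProofSystemFor V TAUT ∧
      (∀ x π, V₀ x π = true → V x π = true) ∧
      ∃ p : Polynomial ℕ, ∀ x ∈ H, ∃ π : List Bool, π.length ≤ p.eval x.length ∧ V x π = true := by
  obtain ⟨L', hL', p, hp⟩ := hH
  set W : Language Bool := (LenLe p ⊓ L') ⊔ {w | Function.uncurry V₀ (boolUnpair w) = true} with hWdef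
  have hW : W ∈ Classes.P :=
    union_mem_P (inter_mem_P (LenLe_mem_P p) hL') (pairLang_mem_P hV₀.1)
  have hmemW : ∀ x π : List Bool,
      boolPair x π ∈ W ↔ (π.length ≤ p.eval x.length ∧ boolPair x π ∈ L') ∨ V₀ x π = true := fun x π => by
    change (boolPair x π ∈ LenLe p ∧ boolPair x π ∈ L') ∨
        Function.uncurry V₀ (boolUnpair (boolPair x π)) = true ↔ _
    rw [boolPair_mem_LenLe, boolUnpair_boolPair]
    rfl
  let V : List Bool → List Bool → Bool := fun x π => W.boolIndicator (boolPair x π)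
  have hVtrue : ∀ x π, V x π = true ↔ boolPair x π ∈ W := fun x π =>
    (Set.mem_iff_boolIndicator W (boolPair x π)).symm
  refine ⟨V, ⟨isPolyTimeVerifier_boolIndicator_of_mem_P hW, fun x => ?_⟩, fun x π hπ => ?_, p, fun x hx => ?_⟩
  · constructor
    · intro hx
      obtain ⟨π, hπ⟩ := (hV₀.mem_iff x).1 hx
      exact ⟨π, (hVtrue x π).2 ((hmemW x π).2 (Or.inr hπ))⟩
    · rintro ⟨π, hπ⟩
      rcases (hmemW x π).1 ((hVtrue x π).1 hπ) with hxH | hV₀π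
      · exact hHT ((hp x).2 ⟨π, hxH.1, hxH.2⟩)
      · exact hV₀.mem_of_eq_true hV₀π
  · exact (hVtrue x π).2 ((hmemW x π).2 (Or.inr hπ))
  · obtain ⟨y, hy, hyL⟩ := (hp x).1 hx
    exact ⟨y, hy, (hVtrue x y).2 ((hmemW x y).2 (Or.inl ⟨hy, hyL⟩))⟩

/-- **STRENGTHENING REFUTED (sharp form): no `NP` set of tautologies is hard for all proof
systems.** It is FALSE that some `H ∈ NP`, `H ⊆ TAUT`, has against EVERY proof system for `TAUT`
and every polynomial bound a member without short proofs (`np_subset_has_short_proofs` with the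
tree's proof system for `TAUT`). Together with Krajíček's criterion this is sharp: a set of
tautologies is hard for all proof systems iff all its `NP` subsets are finite — so any ladder whose
family is `NP`-recognisable (a fortiori `P`-recognisable: PHP, Tseitin on explicit graphs, `τ_b(A)`
for a linear `A`) tops out below `X`. [cite: KrajicekProofComplexity2019, Lemma 19.4.1] -/
theorem not_exists_np_hard_core :
    ¬ ∃ H : Language Bool, H ∈ Nondeterministic.NP ∧ H ≤ TAUT ∧
      ∀ V : List Bool → List Bool → Bool, IsProofSystemFor V TAUT → ∀ q : Polynomial ℕ,
        ∃ x ∈ H, ∀ π : List Bool, π.length ≤ q.eval x.length → V x π = false := by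
  rintro ⟨H, hH, hHT, hhard⟩
  have h₀ : ∃ V₀, IsProofSystemFor V₀ TAUT := exists_isProofSystemFor_TAUT_holds
  obtain ⟨V₀, hV₀⟩ := h₀
  obtain ⟨V, hV, -, p, hHV⟩ := np_subset_has_short_proofs hH hHT hV₀
  obtain ⟨x, hx, hno⟩ := hhard V hV p
  obtain ⟨π, hπ, hVπ⟩ := hHV x hx
  have := hno π hπ
  rw [hVπ] at this
  exact Bool.noConfusion this

end Summit.PneNP.PneNP.Theorems.ProofcplxThesis.Negative
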